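import Mathlib
import HarnessLib
import Summits.HubbardSuperconductivity.HubbardSuperconductivity.Theorems.KLProgrammeKLRegimeEnginePairTransferGridDLineGram
import Summits.HubbardSuperconductivity.HubbardSuperconductivity.Theorems.KLProgrammeKLRegimeEnginePairTransferBaseGridBinomial

/-!
# Route `KLProgramme` — ENGINE child gen 8 (stmt-HubbardSuperconductivity-20437 `KLRegimeEngineV17F2`), skeleton v2 class #5 rev 3, Ẽ-organisation: the BASE smearing row CLOSED at scale `0` —
# `klmg_inner_graded_le`, **`klmg_memberAmplitude_sub_le_of_gridStep`**, **`klmg_memberAmplitude_sub_le_of_frameOK`**, **`klmg_memberAmplitude_sub_le_sq`** (BASE existential: companion `…BaseScaleZeroData`)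
# (cell gate-hubbard-kl, seat hubbard-kl-k3c1-p1 g14, technique «composed-map remainder propagation»: TWO smearing levels `(e^{Δ_{S_D}} − 1)·e^{Δ_{S_{j′}}}` through k3c2-p1 g5's scale-0 step)

WHY.  After rows 47/50 the (X).3 producer's BASE (row 26's clause, produced by `klmf_baseData_of_gridBinomial`) asks for the pinned GRID kernel norms `NH` of the member-`j′` carrier
`e^{Δ_{SᵀS_{0,j′}S}}Gg₀` and ONE number.  k3c2-p1 g5 (`…EngineScaleZeroTransfer`) already controls the grid action `Gg₀ = effAction (SᵀC^{K₀}_{>e₀}S)(V_N + 𝒩_{K₀,N})` by GRADED pinned norms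
`NF(m′) = ρ⁻²ᵐ′·A·θ^{m′−2}` (determinant bound) and closes the ONE-member transfer `‖𝒜₀[D] − 𝒞₀‖ ≤ klTransferC R·U²`.  This file runs the same machinery through TWO smearing levels — the
member-`j′` line `γ² ≤ 6047` then the `D`-line `κD² = Λ₀·klIdxMass 0 j′` (row 50) — and closes the BASE:
`klmg_inner_graded_le` (inner geometric majorant: the smeared carrier's pinned norms keep the graded shape with `ρᵢ ↦ 2ρᵢ`, `A ↦ 2A`); **`klmg_memberAmplitude_sub_le_of_gridStep`** (parametric
in the step data + `γ`, `κD`, `4γ²θρ⁻² ≤ 1/2`, `4κD²θ(2ρ⁻¹)² ≤ 1/2`): `‖𝒜₀[S_{ψ₁}] − 𝒜₀[S_{ψ₂}]‖ ≤ (96N/β)·(80·(2A)·(2ρ⁻¹)⁴·(4κD²θ(2ρ⁻¹)²))`; **`…_of_frameOK`** (κ₀ = ρ = √12108,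
γ = √6047, κD = √(Λ₀·klIdxMass 0 j′), θ ≤ 1/4); **`klmg_memberAmplitude_sub_le_sq`** — CLOSED: `R.WF`, `0 < U ≤ 1`, `FrameOK`, `klBetaMin ≤ β ≤ L`, `β³ ≤ M`, `klScaleZeroThetaC R·U ≤ 1/4`,
`j′ ≤ j` ⟹ `‖𝒜₀[S_{0,j}](Q;k,k′) − 𝒜₀[S_{0,j′}](Q;k,k′)‖ ≤ (4/6047)·klIdxMass 0 j′·(klTransferC R·U²)` (MASS-sensitive: `128·Λ₀·ms/6047 = 4ms/6047`); **`klmf_baseData_of_scaleZero`** — the BASE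
existential of rows 26/51 from the two a priori rows and ONE scalar inequality `(4/6047)·ms·(klTransferC R·U²) + 4·mA²·ms ≤ θ·r·(KlamU)²·ms`, `ms = klIdxMass 0 j′`.
Composition over k3c2-p1 g5's scale-0 files + rows 45/47/50; nothing else about the model is asserted; nothing asserts (X).3, (c), K3 or superconductivity.  0 kit · 0 lit.
-/

noncomputable section

namespace Summit.HubbardSuperconductivity.HubbardSuperconductivity.Theorems.KLRegimeSplit

set_option linter.dupNamespace false -- summit = problem name (single-conjunct summit), D-0017

open Real Finset Matrix Set Literature.MathematicalPhysics.QuantumLattice Literature.Probability.LatticeModels GrassmannAlgebra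
open Summit.HubbardSuperconductivity.HubbardSuperconductivity.Theorems.KLProgrammeCooperResummation
open Summit.HubbardSuperconductivity.HubbardSuperconductivity.Theorems.KLProgrammeLegKernels
open Summit.HubbardSuperconductivity.HubbardSuperconductivity.Theorems.DispersionFlow
open Summit.HubbardSuperconductivity.HubbardSuperconductivity.Theorems.KLRegimeWick
open Summit.HubbardSuperconductivity.HubbardSuperconductivity.Theorems.EngineV8
open Summit.HubbardSuperconductivity.HubbardSuperconductivity.Theorems.ScaleZeroDecay

/-! ## §1 The inner geometric majorant -/

/-- **The inner geometric majorant**: with `y = 4γ²θρᵢ² ≤ 1/2` and `2 < m′`,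
`Σ_{m″ < B} [m′ ≤ m″]·C(2m″,2m′)·γ^{2m″−2m′}·(ρᵢ^{2m″}·A·θ^{m″−2}) ≤ (2ρᵢ)^{2m′}·(2A)·θ^{m′−2}` (`C(2m″,2m′) ≤ 4^{m″}`, `Σ yᵏ ≤ 2`). -/
theorem klmg_inner_graded_le (B : ℕ) {γ θ ρi A : ℝ} (hγ : 0 ≤ γ) (hθ : 0 ≤ θ) (hρi : 0 ≤ ρi) (hA : 0 ≤ A)
    (hy : 4 * (γ ^ 2 * θ * ρi ^ 2) ≤ 1 / 2) {m' : ℕ} (hm' : 2 < m') :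
    ∑ m'' ∈ range B, (if m' ≤ m'' then ((2 * m'').choose (2 * m') : ℝ) * γ ^ (2 * m'' - 2 * m') * (ρi ^ (2 * m'') * A * θ ^ (m'' - 2)) else 0) ≤
      (2 * ρi) ^ (2 * m') * (2 * A) * θ ^ (m' - 2) := by
  set y : ℝ := 4 * (γ ^ 2 * θ * ρi ^ 2) with hy_def
  have hy0 : 0 ≤ y := by positivity
  have hy1 : y < 1 := by linarith
  set X : ℝ := (2 * ρi) ^ (2 * m') * A * θ ^ (m' - 2) with hX
  have hX0 : 0 ≤ X := by positivity
  -- termwise: `≤ X·y^{m″−m′}` on `m′ ≤ m″`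
  have hterm : ∀ m'' : ℕ, (if m' ≤ m'' then ((2 * m'').choose (2 * m') : ℝ) * γ ^ (2 * m'' - 2 * m') * (ρi ^ (2 * m'') * A * θ ^ (m'' - 2)) else 0) ≤
      X * (if m' ≤ m'' then y ^ (m'' - m') else 0) := by
    intro m''
    split_ifs with hm
    · obtain ⟨k, rfl⟩ : ∃ k, m'' = m' + k := ⟨m'' - m', by omega⟩
      have hch : ((2 * (m' + k)).choose (2 * m') : ℝ) ≤ (4 : ℝ) ^ (m' + k) := by
        have h := Nat.choose_le_two_pow (2 * (m' + k)) (2 * m')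
        rw [pow_mul] at h
        exact_mod_cast h
      have hrest : 0 ≤ γ ^ (2 * (m' + k) - 2 * m') * (ρi ^ (2 * (m' + k)) * A * θ ^ (m' + k - 2)) := by positivity
      calc ((2 * (m' + k)).choose (2 * m') : ℝ) * γ ^ (2 * (m' + k) - 2 * m') * (ρi ^ (2 * (m' + k)) * A * θ ^ (m' + k - 2))
          ≤ (4 : ℝ) ^ (m' + k) * (γ ^ (2 * (m' + k) - 2 * m') * (ρi ^ (2 * (m' + k)) * A * θ ^ (m' + k - 2))) := by
            rw [mul_assoc]; exact mul_le_mul_of_nonneg_right hch hrest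
        _ = X * y ^ (m' + k - m') := by
            rw [hX, hy_def, show 2 * (m' + k) - 2 * m' = 2 * k by omega, show m' + k - m' = k by omega,
              show m' + k - 2 = (m' - 2) + k by omega, show 2 * (m' + k) = 2 * m' + 2 * k by ring]
            have h4 : (4 : ℝ) ^ (m' + k) = (2 ^ 2) ^ m' * 4 ^ k := by rw [pow_add]; norm_num
            rw [h4]
            simp only [pow_add, pow_mul, mul_pow]
            ring
    · exact le_of_eq (by simp)
  refine (sum_le_sum fun m'' _ => hterm m'').trans ?_
  rw [← mul_sum]
  -- `Σ_{m″ < B} [m′ ≤ m″] y^{m″−m′} ≤ 2`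
  have hgeo : ∑ m'' ∈ range B, (if m' ≤ m'' then y ^ (m'' - m') else 0) ≤ 2 := by
    rw [← Finset.sum_filter]
    have hset : (range B).filter (fun m'' => m' ≤ m'') = Finset.Ico m' B := by
      ext m''
      simp only [Finset.mem_filter, Finset.mem_range, Finset.mem_Ico]
      omega
    rw [hset]
    rcases le_or_gt m' B with hB | hB
    · rw [Finset.sum_Ico_eq_sum_range]
      simp only [show ∀ i : ℕ, m' + i - m' = i from fun i => by omega]
      have h := geom_sum_Ico_le_of_lt_one (m := 0) (n := B - m') hy0 hy1
      rw [Finset.range_eq_Ico]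
      refine h.trans ?_
      rw [pow_zero, div_le_iff₀ (by linarith)]
      linarith
    · rw [Finset.Ico_eq_empty (by omega), Finset.sum_empty]; norm_num
  calc X * ∑ m'' ∈ range B, (if m' ≤ m'' then y ^ (m'' - m') else 0) ≤ X * 2 := mul_le_mul_of_nonneg_left hgeo hX0
    _ = (2 * ρi) ^ (2 * m') * (2 * A) * θ ^ (m' - 2) := by rw [hX]; ring

/-! ## §2 The two-level member transfer at scale `0`, parametric in the step data -/

section Step

variable {L M : ℕ} [NeZero L]

/-- **`klmg_memberAmplitude_sub_le_of_gridStep`** — the difference of two soft-line members of the scale-`0` pair amplitude from ONE determinant-bounded grid step (data as in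
`norm_klCovSmearedPairAmplitude_zero_sub_le_of_gridStep`) and TWO Gram constants on the grid: `γ` of `Sᵀ·softCovOf K ψ₂·S` and `κD` of `Sᵀ·softCovOf K (ψ₁ − ψ₂)·S`;
if `4γ²θρ⁻² ≤ 1/2` and `4κD²θ(2ρ⁻¹)² ≤ 1/2`, then `‖𝒜₀[S_{ψ₁}](Q;k,k′) − 𝒜₀[S_{ψ₂}](Q;k,k′)‖ ≤ (96·N/β)·(80·(2A)·(2ρ⁻¹)⁴·(4κD²θ(2ρ⁻¹)²))`, `A = e‖Ṽ‖_h/(1−θ)`. -/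
theorem klmg_memberAmplitude_sub_le_of_gridStep [NeZero M] {β : ℝ} (hβ : 0 < β) (U μ : ℝ) (K : TrigPolyC4v)
    {κ : ℝ} (hκ : 0 < κ)
    (hGB : IsGramBoundedR ((hubbardGridSub L M β (2 * (2 * M))).transpose * hubbardCovAboveCT L M β μ 0 K klE0 *
      hubbardGridSub L M β (2 * (2 * M))) κ)
    {α : ℝ} (hα : 0 < α)
    (hrow : ∀ X, ∑ Y, ‖((hubbardGridSub L M β (2 * (2 * M))).transpose * hubbardCovAboveCT L M β μ 0 K klE0 *
      hubbardGridSub L M β (2 * (2 * M))) X Y‖ ≤ α)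
    (hcol : ∀ Y, ∑ X, ‖((hubbardGridSub L M β (2 * (2 * M))).transpose * hubbardCovAboveCT L M β μ 0 K klE0 *
      hubbardGridSub L M β (2 * (2 * M))) X Y‖ ≤ α)
    {ρ : ℝ} (hρ : 0 < ρ) {N₁ : ℝ} (hN₁ : 0 ≤ N₁)
    (hct : ∀ (j : Fin 2) (w : GridLeg (GridPoint L (2 * (2 * M)))),
      ∑ Y ∈ univ.filter (fun Y : Fin 2 → GridLeg (GridPoint L (2 * (2 * M))) => Y j = w),
        ‖kernel ℂ (hubbardGridCounterQuadratic L (2 * (2 * M)) β K) 2 Y‖ ≤ N₁)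
    (hθ : Real.exp 1 * α * normV (GridLeg (GridPoint L (2 * (2 * M)))) κ ρ
      (fun m' : ℕ => if m' = 1 then N₁ else if m' = 2 then |U| * |β| / (2 * (2 * M) : ℕ) else 0) / κ ^ 2 < 1)
    (ψ₁ ψ₂ : FreqMomentum L M → ℝ)
    {γ : ℝ} (hγ : 0 ≤ γ) (hGγ : IsGramBoundedR ((hubbardGridSub L M β (2 * (2 * M))).transpose * softCovOf L M β μ K ψ₂ * hubbardGridSub L M β (2 * (2 * M))) γ)
    {κD : ℝ} (hκD : 0 ≤ κD) (hGD : IsGramBoundedR ((hubbardGridSub L M β (2 * (2 * M))).transpose * softCovOf L M β μ K (ψ₁ - ψ₂) * hubbardGridSub L M β (2 * (2 * M))) κD)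
    (hy : 4 * (γ ^ 2 * (Real.exp 1 * α * normV (GridLeg (GridPoint L (2 * (2 * M)))) κ ρ
      (fun m' : ℕ => if m' = 1 then N₁ else if m' = 2 then |U| * |β| / (2 * (2 * M) : ℕ) else 0) / κ ^ 2) * ρ⁻¹ ^ 2) ≤ 1 / 2)
    (hyD : 4 * (κD ^ 2 * (Real.exp 1 * α * normV (GridLeg (GridPoint L (2 * (2 * M)))) κ ρ
      (fun m' : ℕ => if m' = 1 then N₁ else if m' = 2 then |U| * |β| / (2 * (2 * M) : ℕ) else 0) / κ ^ 2) * (2 * ρ⁻¹) ^ 2) ≤ 1 / 2)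
    (Qm k k' : TorusSite 2 L) :
    ‖klCovSmearedPairAmplitude L M β U μ K 0 (softCovOf L M β μ K ψ₁) Qm k k' - klCovSmearedPairAmplitude L M β U μ K 0 (softCovOf L M β μ K ψ₂) Qm k k'‖ ≤
      96 * ((2 * (2 * M) : ℕ) : ℝ) / β *
        (80 * (2 * (Real.exp 1 * normV (GridLeg (GridPoint L (2 * (2 * M)))) κ ρ
              (fun m' : ℕ => if m' = 1 then N₁ else if m' = 2 then |U| * |β| / (2 * (2 * M) : ℕ) else 0) /
            (1 - Real.exp 1 * α * normV (GridLeg (GridPoint L (2 * (2 * M)))) κ ρ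
              (fun m' : ℕ => if m' = 1 then N₁ else if m' = 2 then |U| * |β| / (2 * (2 * M) : ℕ) else 0) / κ ^ 2))) *
          (2 * ρ⁻¹) ^ 4 *
          (4 * (κD ^ 2 * (Real.exp 1 * α * normV (GridLeg (GridPoint L (2 * (2 * M)))) κ ρ
            (fun m' : ℕ => if m' = 1 then N₁ else if m' = 2 then |U| * |β| / (2 * (2 * M) : ℕ) else 0) / κ ^ 2) * (2 * ρ⁻¹) ^ 2))) := by
  -- notation (as in `norm_klCovSmearedPairAmplitude_zero_sub_le_of_gridStep`)
  set Ng : ℕ := 2 * (2 * M) with hNg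
  haveI : NeZero Ng := ⟨by rw [hNg]; have := NeZero.ne M; omega⟩
  set S := hubbardGridSub L M β Ng with hS
  set C' := S.transpose * hubbardCovAboveCT L M β μ 0 K klE0 * S with hC'
  set Vt := hubbardGridInteraction L Ng β U + hubbardGridCounterQuadratic L Ng β K with hVt
  set prof : ℕ → ℝ := fun m' : ℕ => if m' = 1 then N₁ else if m' = 2 then |U| * |β| / Ng else 0 with hprof
  set nV : ℝ := normV (GridLeg (GridPoint L Ng)) κ ρ prof with hnV
  set θ : ℝ := Real.exp 1 * α * nV / κ ^ 2 with hθdef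
  set A : ℝ := Real.exp 1 * nV / (1 - θ) with hA
  have hL : (0 : ℝ) < L := by exact_mod_cast Nat.pos_of_ne_zero (NeZero.ne L)
  have hnV0 : 0 ≤ nV := by rw [hnV]; exact normV_nonneg hκ.le hρ.le (klsv_profile_nonneg β U Ng hN₁)
  have hθ0 : 0 ≤ θ := by positivity
  have hθ1 : θ < 1 := hθ
  have hA0 : 0 ≤ A := div_nonneg (by positivity) (by linarith)
  -- (1) the graded pinned kernel norms of the grid action `F` (k3c2-p1 g5's step (2), verbatim)
  set F := effAction ℂ C' Vt with hF
  have hVt_even : Vt ∈ evenPart ℂ (GridLeg (GridPoint L Ng)) :=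
    add_mem (hubbardGridInteraction_mem_evenPart β U) (hubbardGridCounterQuadratic_mem_evenPart β K)
  have hVt0 : constPart ℂ Vt = 0 := by
    rw [hVt, map_add, constPart_hubbardGridInteraction, constPart_hubbardGridCounterQuadratic, add_zero]
  have hF_even : F ∈ evenPart ℂ (GridLeg (GridPoint L Ng)) := effAction_mem_evenPart C' hVt_even hVt0
  set NF : ℕ → ℝ := fun m' => ρ⁻¹ ^ (2 * m') * A * θ ^ (m' - 2) with hNF
  have hNF0 : ∀ m', 0 ≤ NF m' := fun m' => by positivity
  have hNF : ∀ (m' : ℕ) (j : Fin (2 * m')) (w : GridLeg (GridPoint L Ng)),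
      ∑ Y ∈ univ.filter (fun Y : Fin (2 * m') → GridLeg (GridPoint L Ng) => Y j = w), ‖kernel ℂ F (2 * m') Y‖ ≤ NF m' := by
    intro m' j w
    rcases Nat.lt_or_ge m' 2 with hm | hm
    · interval_cases m'
      · exact absurd j.2 (by omega)
      · have h := (sum_norm_kernel_effAction_le_of_gramBounded C' hκ hGB Vt hVt_even hVt0 prof (klsv_profile_nonneg β U Ng hN₁)
          (klsv_sum_norm_kernel_gridVertex_le β U K hN₁ hct) hα hrow hcol hρ hθ).2 (m := 2 * 1) (by norm_num) j w
        refine h.trans (le_of_eq ?_)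
        simp only [hNF, hA, show (1 : ℕ) - 2 = 0 from rfl, pow_zero, mul_one]
        ring
    · have hdeg : ∀ m'', 2 < m'' → ∀ Y : Fin (2 * m'') → GridLeg (GridPoint L Ng), kernel ℂ Vt (2 * m'') Y = 0 := fun m'' hm'' Y => by
        rw [hVt, kernel_add, kernel_hubbardGridInteraction_of_ne β U (by omega) Y, kernel_hubbardGridCounterQuadratic_of_ne β K (by omega) Y,
          add_zero]
      exact (sum_norm_kernel_effAction_le_pow_of_gramBounded_quartic C' hκ hGB Vt hVt_even hVt0 prof (klsv_profile_nonneg β U Ng hN₁)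
        (klsv_sum_norm_kernel_gridVertex_le β U K hN₁ hct) hdeg hα hrow hcol hρ hθ hm j w).2.trans (le_of_eq (by simp only [hNF, hA]; ring))
  -- (2) the member-2 carrier `H = e^{Δ_{SᵀS_{ψ₂}S}}F`: pinned norms by the first-order binomial–Gram bound
  set NH : ℕ → ℝ := fun m' => ∑ m'' ∈ range (Fintype.card (GridLeg (GridPoint L Ng)) / 2 + 1),
    if m' ≤ m'' then ((2 * m'').choose (2 * m') : ℝ) * γ ^ (2 * m'' - 2 * m') * NF m'' else 0 with hNH
  have hNH0 : ∀ m', 0 ≤ NH m' := fun m' => klmd_binomialProfile_nonneg hγ NF hNF0 _ m'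
  have hNHb : ∀ (m' : ℕ) (i : Fin (2 * m')) (w : GridLeg (GridPoint L Ng)),
      ∑ Y ∈ univ.filter (fun Y : Fin (2 * m') → GridLeg (GridPoint L Ng) => Y i = w),
        ‖kernel ℂ (gaussConv ℂ (S.transpose * softCovOf L M β μ K ψ₂ * S) F) (2 * m') Y‖ ≤ NH m' := fun m' i w =>
    klmg_sum_norm_kernel_gaussConv_le_binomial hγ hGγ F hF_even NF hNF0 hNF m' i w
  -- (3) the member difference in degree 4 through `(e^{Δ_{SᵀS_DS}} − 1)` (row 47's lemma), then the two geometric levels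
  have hsc : klScale klE0 0 = klE0 := by simp [klScale]
  have hmain := klmg_covSmearedPairAmplitude_sub_le_gridBinomial L M hβ U μ K 0 ψ₁ ψ₂ hκD hGD NH hNH0 (by rw [hsc]; exact hNHb) Qm k k'
  have hinner : ∀ m' : ℕ, 2 < m' → NH m' ≤ (2 * ρ⁻¹) ^ (2 * m') * (2 * A) * θ ^ (m' - 2) := fun m' hm' => by
    rw [hNH]
    exact klmg_inner_graded_le _ hγ hθ0 (by positivity) hA0 hy hm'
  have hsum : ∑ m' ∈ range (Fintype.card (GridLeg (GridPoint L Ng)) / 2 + 1),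
      (if 2 < m' then ((2 * m').choose (2 * 2) : ℝ) * κD ^ (2 * m' - 2 * 2) * NH m' else 0) ≤
        80 * (2 * A) * (2 * ρ⁻¹) ^ 4 * (4 * (κD ^ 2 * θ * (2 * ρ⁻¹) ^ 2)) := by
    have hle : ∑ m' ∈ range (Fintype.card (GridLeg (GridPoint L Ng)) / 2 + 1),
        (if 2 < m' then ((2 * m').choose (2 * 2) : ℝ) * κD ^ (2 * m' - 2 * 2) * NH m' else 0) ≤
        ∑ m' ∈ range (Fintype.card (GridLeg (GridPoint L Ng)) / 2 + 1),
          (if 2 < m' then (((2 * m').choose (2 * 2) : ℕ) : ℝ) * κD ^ (2 * m' - 2 * 2) * ((2 * ρ⁻¹) ^ (2 * m') * (2 * A) * θ ^ (m' - 2)) else 0) := by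
      refine sum_le_sum fun m' _ => ?_
      split_ifs with hm
      · exact mul_le_mul_of_nonneg_left (hinner m' hm) (by positivity)
      · exact le_rfl
    exact hle.trans (sum_ite_choose_graded_le _ hκD hθ0 (by positivity) (by positivity) hyD)
  -- (4) values
  refine hmain.trans ?_
  rw [card_gridLeg_gridPoint, show ((Nat.factorial (2 * 2) : ℕ) : ℝ) = 24 by norm_num [Nat.factorial]]
  have hpref : 0 ≤ (24 : ℝ) / (β * (L : ℝ) ^ 2) * ((4 * Ng * L ^ 2 : ℕ) : ℝ) := by positivity
  calc (24 : ℝ) / (β * (L : ℝ) ^ 2) * (((4 * Ng * L ^ 2 : ℕ) : ℝ) *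
        ∑ m' ∈ range (((4 * Ng * L ^ 2 : ℕ)) / 2 + 1), (if 2 < m' then ((2 * m').choose (2 * 2) : ℝ) * κD ^ (2 * m' - 2 * 2) * NH m' else 0))
      ≤ (24 : ℝ) / (β * (L : ℝ) ^ 2) * (((4 * Ng * L ^ 2 : ℕ) : ℝ) * (80 * (2 * A) * (2 * ρ⁻¹) ^ 4 * (4 * (κD ^ 2 * θ * (2 * ρ⁻¹) ^ 2)))) := by
        rw [card_gridLeg_gridPoint] at hsum
        exact mul_le_mul_of_nonneg_left (mul_le_mul_of_nonneg_left hsum (by positivity)) (by positivity)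
    _ = 96 * ((Ng : ℕ) : ℝ) / β * (80 * (2 * A) * (2 * ρ⁻¹) ^ 4 * (4 * (κD ^ 2 * θ * (2 * ρ⁻¹) ^ 2))) := by
        push_cast
        field_simp
        ring

/-! ## §3 At the tree's scale-`0` constants -/

/-- **`klmg_memberAmplitude_sub_le_of_frameOK`** — the same at `κ₀ = ρ = √(2(7+6047))` (`isGramBoundedR_scaleZero_of_frameOK_sharp`), `γ = √6047` for the member line
`s_{0,j′}` (`isGramBoundedR_gridSub_softSubCov_zero`) and `κD = √(Λ₀·klIdxMass 0 j′)` for the `D`-line (row 50), for `θ ≤ 1/4`, `0 ≤ j′ ≤ j`, modulo the decay `α` and the degree-2 size `N₁`. -/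
theorem klmg_memberAmplitude_sub_le_of_frameOK [NeZero M] {R : RenConsts} {U : ℝ} {Nsc : ℕ} {μ : ℝ} {K : TrigPolyC4v}
    (hK : FrameOK R U Nsc μ K) {β : ℝ} (hβ : klBetaMin ≤ β) (hβL : β ≤ L)
    {α : ℝ} (hα : 0 < α)
    (hrow : ∀ X, ∑ Y, ‖((hubbardGridSub L M β (2 * (2 * M))).transpose * hubbardCovAboveCT L M β μ 0 K klE0 *
      hubbardGridSub L M β (2 * (2 * M))) X Y‖ ≤ α)
    (hcol : ∀ Y, ∑ X, ‖((hubbardGridSub L M β (2 * (2 * M))).transpose * hubbardCovAboveCT L M β μ 0 K klE0 *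
      hubbardGridSub L M β (2 * (2 * M))) X Y‖ ≤ α)
    {N₁ : ℝ} (hN₁ : 0 ≤ N₁)
    (hct : ∀ (j : Fin 2) (w : GridLeg (GridPoint L (2 * (2 * M)))),
      ∑ Y ∈ univ.filter (fun Y : Fin 2 → GridLeg (GridPoint L (2 * (2 * M))) => Y j = w),
        ‖kernel ℂ (hubbardGridCounterQuadratic L (2 * (2 * M)) β K) 2 Y‖ ≤ N₁)
    (hθ : Real.exp 1 * α * normV (GridLeg (GridPoint L (2 * (2 * M)))) (Real.sqrt (2 * (7 + 6047))) (Real.sqrt (2 * (7 + 6047)))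
      (fun m' : ℕ => if m' = 1 then N₁ else if m' = 2 then |U| * |β| / (2 * (2 * M) : ℕ) else 0) / Real.sqrt (2 * (7 + 6047)) ^ 2 ≤ 1 / 4)
    {j j' : ℕ} (hj : j' ≤ j) (Qm k k' : TorusSite 2 L) :
    ‖klCovSmearedPairAmplitude L M β U μ K 0 (softCovOf L M β μ K (softSymbolCompl L M β μ K 0 j)) Qm k k' -
        klCovSmearedPairAmplitude L M β U μ K 0 (softCovOf L M β μ K (softSymbolCompl L M β μ K 0 j')) Qm k k'‖ ≤
      96 * ((2 * (2 * M) : ℕ) : ℝ) / β *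
        (80 * (2 * (Real.exp 1 * normV (GridLeg (GridPoint L (2 * (2 * M)))) (Real.sqrt (2 * (7 + 6047))) (Real.sqrt (2 * (7 + 6047)))
              (fun m' : ℕ => if m' = 1 then N₁ else if m' = 2 then |U| * |β| / (2 * (2 * M) : ℕ) else 0) /
            (1 - Real.exp 1 * α * normV (GridLeg (GridPoint L (2 * (2 * M)))) (Real.sqrt (2 * (7 + 6047))) (Real.sqrt (2 * (7 + 6047)))
              (fun m' : ℕ => if m' = 1 then N₁ else if m' = 2 then |U| * |β| / (2 * (2 * M) : ℕ) else 0) / Real.sqrt (2 * (7 + 6047)) ^ 2))) *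
          (2 * (Real.sqrt (2 * (7 + 6047)))⁻¹) ^ 4 *
          (4 * ((Real.sqrt (klScale klE0 0 * klIdxMass 0 j')) ^ 2 * (Real.exp 1 * α * normV (GridLeg (GridPoint L (2 * (2 * M)))) (Real.sqrt (2 * (7 + 6047)))
            (Real.sqrt (2 * (7 + 6047))) (fun m' : ℕ => if m' = 1 then N₁ else if m' = 2 then |U| * |β| / (2 * (2 * M) : ℕ) else 0) /
              Real.sqrt (2 * (7 + 6047)) ^ 2) * (2 * (Real.sqrt (2 * (7 + 6047)))⁻¹) ^ 2))) := by
  have hβpos : 0 < β := pos_of_klBetaMin_le hβ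
  have hκ : 0 < Real.sqrt (2 * (7 + 6047)) := Real.sqrt_pos.2 (by norm_num)
  set θ : ℝ := Real.exp 1 * α * normV (GridLeg (GridPoint L (2 * (2 * M)))) (Real.sqrt (2 * (7 + 6047))) (Real.sqrt (2 * (7 + 6047)))
      (fun m' : ℕ => if m' = 1 then N₁ else if m' = 2 then |U| * |β| / (2 * (2 * M) : ℕ) else 0) / Real.sqrt (2 * (7 + 6047)) ^ 2 with hθdef
  have hθ0 : 0 ≤ θ := by
    rw [hθdef]
    exact div_nonneg (mul_nonneg (by positivity) (normV_nonneg hκ.le hκ.le (klsv_profile_nonneg β U _ hN₁))) (by positivity)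
  have hθ1 : θ < 1 := by linarith
  -- inner smallness `4γ²θ/κ₀² ≤ 1/2` and outer smallness `4κD²θ(2/κ₀)² ≤ 1/2` from `θ ≤ 1/4`, `κD² = Λ₀·ms ≤ 15367/32`
  have hy : 4 * ((Real.sqrt 6047) ^ 2 * θ * (Real.sqrt (2 * (7 + 6047)))⁻¹ ^ 2) ≤ 1 / 2 := by
    rw [Real.sq_sqrt (by norm_num), inv_pow, Real.sq_sqrt (by norm_num)]
    nlinarith
  have hms : klScale klE0 0 * klIdxMass 0 j' ≤ 15367 / 32 := by
    have h1 := klIdxMass_le 0 j'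
    have h0 := klIdxMass_nonneg 0 j'
    rw [show klScale klE0 0 = 1 / 32 by simp [klScale, klE0]]
    nlinarith
  have hms0 : 0 ≤ klScale klE0 0 * klIdxMass 0 j' := mul_nonneg (klth_klScale_pos 0).le (klIdxMass_nonneg 0 j')
  have hyD : 4 * ((Real.sqrt (klScale klE0 0 * klIdxMass 0 j')) ^ 2 * θ * (2 * (Real.sqrt (2 * (7 + 6047)))⁻¹) ^ 2) ≤ 1 / 2 := by
    rw [Real.sq_sqrt hms0, mul_pow, inv_pow, Real.sq_sqrt (by norm_num)]
    nlinarith [mul_nonneg hms0 hθ0]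
  exact klmg_memberAmplitude_sub_le_of_gridStep hβpos U μ K hκ (isGramBoundedR_scaleZero_of_frameOK_sharp hK hβ hβL) hα hrow hcol hκ hN₁ hct hθ1 _ _
    (Real.sqrt_nonneg _) (isGramBoundedR_gridSub_softSubCov_zero hK hβ hβL (isSoftSubCov_softCovOf (isSoftSymbol_compl β μ K (Nat.zero_le j'))))
    (Real.sqrt_nonneg _) (klmg_isGramBoundedR_gridSub_dLine L M hK hβ hβL (Nat.zero_le j') hj _) hy hyD Qm k k'

/-! ## §4 The closed constant -/

/-- **`klmg_memberAmplitude_sub_le_sq`** — CLOSED, mass-sensitive: for `R.WF`, `0 < U ≤ 1`, `FrameOK R U N μ K`, `klBetaMin ≤ β ≤ L`, `β³ ≤ M`, `klScaleZeroThetaC R·U ≤ 1/4`,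
`j′ ≤ j` and every `Q, k, k′`: `‖𝒜₀[S_{0,j}](Q;k,k′) − 𝒜₀[S_{0,j′}](Q;k,k′)‖ ≤ (4/6047)·klIdxMass 0 j′·(klTransferC R·U²)`. -/
theorem klmg_memberAmplitude_sub_le_sq [NeZero M] {R : RenConsts} (hR : R.WF) {U : ℝ} (hU : 0 < U) (hU1 : U ≤ 1)
    {Nsc : ℕ} {μ : ℝ} {K : TrigPolyC4v} (hK : FrameOK R U Nsc μ K) {β : ℝ} (hβ : klBetaMin ≤ β) (hβL : β ≤ L)
    (hβM : β ^ 3 ≤ (M : ℝ)) (hθ : klScaleZeroThetaC R * U ≤ 1 / 4) {j j' : ℕ} (hj : j' ≤ j) (Qm k k' : TorusSite 2 L) :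
    ‖klCovSmearedPairAmplitude L M β U μ K 0 (softCovOf L M β μ K (softSymbolCompl L M β μ K 0 j)) Qm k k' -
        klCovSmearedPairAmplitude L M β U μ K 0 (softCovOf L M β μ K (softSymbolCompl L M β μ K 0 j')) Qm k k'‖ ≤
      4 / 6047 * klIdxMass 0 j' * (klTransferC R * U ^ 2) := by
  -- notation and signs (as in `norm_klCovSmearedPairAmplitude_zero_sub_le_sq`)
  set Ng : ℕ := 2 * (2 * M) with hNg
  haveI : NeZero Ng := ⟨by rw [hNg]; have := NeZero.ne M; omega⟩
  have hβ0 : 0 < β := pos_of_klBetaMin_le hβ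
  have hN0 : 0 < ((Ng : ℕ) : ℝ) := by exact_mod_cast Nat.pos_of_ne_zero (NeZero.ne Ng)
  have hUabs : |U| = U := abs_of_pos hU
  have hU1' : |U| ≤ 1 := by rwa [hUabs]
  have hG0 : 0 ≤ R.Gfr 0 := hR.2.2 0
  set κ₀ : ℝ := Real.sqrt (2 * (7 + 6047)) with hκ₀
  have hκ : 0 < κ₀ := Real.sqrt_pos.2 (by norm_num)
  have hA0 := klScaleZeroA0_pos
  have hCV := klScaleZeroCV_pos hG0
  -- the decay constant
  set α : ℝ := ((Ng : ℕ) : ℝ) / β * klScaleZeroA0 with hα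
  have hαpos : 0 < α := by positivity
  have hrow := fun X => rowSum_scaleZero_le_A0 (L := L) (μ := μ) hK hβ hβM X
  have hcol := fun Y => colSum_scaleZero_le_A0 (L := L) (μ := μ) hK hβ hβM Y
  -- the degree-2 size
  set kK : ℝ := klKappaFrameC R * |U| with hkK
  have hkKframe : ∑ z : TorusSite 2 L, ‖framePosKernel L K z‖ ≤ kK :=
    sum_norm_framePosKernel_le_linear_of_frameOK hR hU.ne' hU1' hK
  set N₁ : ℝ := |β| / Ng * kK with hN₁
  have hkK0 : 0 ≤ kK := by rw [hkK]; exact mul_nonneg (klKappaFrameC_pos hG0).le (abs_nonneg U)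
  have hN₁0 : 0 ≤ N₁ := by positivity
  have hct : ∀ (j : Fin 2) (w : GridLeg (GridPoint L Ng)),
      ∑ Y ∈ univ.filter (fun Y : Fin 2 → GridLeg (GridPoint L Ng) => Y j = w),
        ‖kernel ℂ (hubbardGridCounterQuadratic L Ng β K) 2 Y‖ ≤ N₁ := fun j w =>
    (sum_norm_kernel_hubbardGridCounterQuadratic_le_l1 β K j w).trans (mul_le_mul_of_nonneg_left hkKframe (by positivity))
  -- the field-weighted norm and the smallness
  set V : ℝ := normV (GridLeg (GridPoint L Ng)) κ₀ κ₀
    (fun m' : ℕ => if m' = 1 then N₁ else if m' = 2 then |U| * |β| / (Ng : ℕ) else 0) with hV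
  have hVeq : V = (Real.exp 2 * (κ₀ + κ₀)) ^ 2 * (|β| / Ng * kK) + (Real.exp 2 * (κ₀ + κ₀)) ^ 4 * (|U| * |β| / Ng) := by
    rw [hV, hN₁]
    exact normV_scaleZeroPinnedL1_eq four_le_card_gridLeg κ₀ κ₀ β U kK Ng
  have hNV : ((Ng : ℕ) : ℝ) / β * V ≤ klScaleZeroCV R * U := by
    rw [hVeq, abs_of_pos hβ0, hkK, hUabs, klScaleZeroCV, ← hκ₀, show κ₀ + κ₀ = 2 * κ₀ by ring]
    have h2 : 0 ≤ (Real.exp 2 * (2 * κ₀)) ^ 2 := sq_nonneg _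
    have h4 : 0 ≤ (Real.exp 2 * (2 * κ₀)) ^ 4 := by positivity
    have hKC : 0 ≤ klKappaFrameC R := (klKappaFrameC_pos hG0).le
    refine le_of_eq ?_
    field_simp
  have hV0 : 0 ≤ V := by
    rw [hV]; exact normV_nonneg hκ.le hκ.le (klsv_profile_nonneg β U Ng hN₁0)
  set θ : ℝ := Real.exp 1 * α * V / κ₀ ^ 2 with hθdef
  have hθle : θ ≤ klScaleZeroThetaC R * U := by
    have h1 : θ = Real.exp 1 * klScaleZeroA0 * (((Ng : ℕ) : ℝ) / β * V) / κ₀ ^ 2 := by rw [hθdef, hα]; ring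
    rw [h1, klScaleZeroThetaC, ← hκ₀]
    have : Real.exp 1 * klScaleZeroA0 * (((Ng : ℕ) : ℝ) / β * V) ≤ Real.exp 1 * klScaleZeroA0 * (klScaleZeroCV R * U) :=
      mul_le_mul_of_nonneg_left hNV (by positivity)
    calc Real.exp 1 * klScaleZeroA0 * (((Ng : ℕ) : ℝ) / β * V) / κ₀ ^ 2
        ≤ Real.exp 1 * klScaleZeroA0 * (klScaleZeroCV R * U) / κ₀ ^ 2 := div_le_div_of_nonneg_right this (by positivity)
      _ = _ := by ring
  have hθq : θ ≤ 1 / 4 := hθle.trans hθ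
  have hθ0 : 0 ≤ θ := by positivity
  -- the mass
  set ms : ℝ := klScale klE0 0 * klIdxMass 0 j' with hms
  have hms0 : 0 ≤ ms := mul_nonneg (klth_klScale_pos 0).le (klIdxMass_nonneg 0 j')
  have hmsE : ms = 1 / 32 * klIdxMass 0 j' := by rw [hms, show klScale klE0 0 = 1 / 32 by simp [klScale, klE0]]
  -- the parametric bound
  have hmain := klmg_memberAmplitude_sub_le_of_frameOK (L := L) (M := M) hK hβ hβL hαpos hrow hcol hN₁0 hct (by rw [← hκ₀]; exact hθq) hj Qm k k'
  rw [← hκ₀, Real.sq_sqrt hms0] at hmain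
  refine hmain.trans ?_
  change 96 * ((Ng : ℕ) : ℝ) / β * (80 * (2 * (Real.exp 1 * V / (1 - θ))) * (2 * κ₀⁻¹) ^ 4 * (4 * (ms * θ * (2 * κ₀⁻¹) ^ 2))) ≤
    4 / 6047 * klIdxMass 0 j' * (klTransferC R * U ^ 2)
  -- `V/(1−θ)·θ ≤ (β/Ng)·CV·U·(4/3)·ThetaC·U`
  have hfrac : θ / (1 - θ) ≤ 4 / 3 * (klScaleZeroThetaC R * U) := by
    rw [div_le_iff₀ (by linarith)]
    nlinarith [mul_nonneg hθ0 (by linarith : (0:ℝ) ≤ klScaleZeroThetaC R * U)]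
  have hκ4 : 0 ≤ κ₀⁻¹ ^ 4 := by positivity
  have hκ2 : 0 ≤ κ₀⁻¹ ^ 2 := by positivity
  have hms' : 0 ≤ klIdxMass 0 j' := klIdxMass_nonneg 0 j'
  calc 96 * ((Ng : ℕ) : ℝ) / β * (80 * (2 * (Real.exp 1 * V / (1 - θ))) * (2 * κ₀⁻¹) ^ 4 * (4 * (ms * θ * (2 * κ₀⁻¹) ^ 2)))
      = 128 * ms * (96 * 80 * 4 * κ₀⁻¹ ^ 4 * κ₀⁻¹ ^ 2 * (Real.exp 1 * (((Ng : ℕ) : ℝ) / β * V)) * (θ / (1 - θ))) := by ring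
    _ ≤ 128 * ms * (96 * 80 * 4 * κ₀⁻¹ ^ 4 * κ₀⁻¹ ^ 2 * (Real.exp 1 * (klScaleZeroCV R * U)) * (4 / 3 * (klScaleZeroThetaC R * U))) := by
        refine mul_le_mul_of_nonneg_left ?_ (by positivity)
        exact mul_le_mul (mul_le_mul_of_nonneg_left (mul_le_mul_of_nonneg_left hNV (by positivity)) (by positivity)) hfrac
          (div_nonneg hθ0 (by linarith)) (by positivity)
    _ = 4 / 6047 * klIdxMass 0 j' * (klTransferC R * U ^ 2) := by
        rw [klTransferC, ← hκ₀, hmsE]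
        field_simp
        ring

end Step


end Summit.HubbardSuperconductivity.HubbardSuperconductivity.Theorems.KLRegimeSplit

end
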